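import Literature.AlgebraicGeometry.Modules.CechSheafAcyclic
import Literature.AlgebraicGeometry.Modules.CechResolution
import Mathlib.AlgebraicGeometry.Morphisms.Affine
import HarnessLib

/-!
# The Čech resolution as a quasi-isomorphism, and the RELATIVE acyclicity of Čech sheaves:
# `Čⁿ(𝓤, M)` is `g_*`-acyclic when the faces of `𝓤` are affine over the base
# (Hartshorne III Lemma 4.2, Thm. 4.5 and Prop. 8.1; The Stacks Project, Tags 01XD, 01XC, 02KE)

Layer `Literature/AlgebraicGeometry/Modules`. Let `X` be a scheme, `𝓤 = (U_i)_{i ∈ ι}` a family of opens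
covering `X`, `M` an `𝒪_X`-module.

* §1 **`Cech.augmentι U M : M[0] ⟶ Č•(𝓤, M)`** — the augmentation of the sheaf Čech complex of
  `Modules/CechResolution` as a morphism from the single complex (`CochainComplex.single₀`), and
  **`Cech.quasiIso_augmentι`**: it is a QUASI-ISOMORPHISM when `𝓤` covers `X` (Hartshorne III Lemma 4.2
  `Cech.exactAugmentation`, read as in Mathlib's `InjectiveResolution.of`).
* §2 **`Cech.isAcyclicOn_obj`** — `Hᵠ⁺¹(O, Čⁿ(𝓤, N)) = 0` (the tree's `IsAcyclicOn`, cohomology of the open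
  `O` on the site of `X`) for an open `O` meeting EVERY face `U_β` of `𝓤` in an AFFINE open, `N` acyclic on
  all affine opens (e.g. quasi-coherent), GIVEN a basis of opens meeting every face affinely: the dimension
  shifting of `Modules/CechSheafAcyclic` (`Ext(𝒪_X, –)`, global sections) rerun with `Ext(ℤ[h_O], –)`
  (sections over `O`): along `0 → N → I → Z → 0`, `I` injective, `Čⁿ` stays short exact
  (`Cech.map_shortExact_of_isBasis`), `Čⁿ(𝓤, I)` is flasque hence acyclic on `O`, and
  `Γ(O, Čⁿ(I)) → Γ(O, Čⁿ(Z))` is onto because `Γ(O ∩ U_β, I) → Γ(O ∩ U_β, Z)` is (`H¹(O ∩ U_β, N) = 0`).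
* §3 the RELATIVE case: a morphism `g : X ⟶ Y` and a cover `𝓤` of `X` whose faces are AFFINE OVER `Y`
  (`IsAffineHom ((face U β).ι ≫ g)`; e.g. `U_i = Y' × A_i` for an affine cover `(A_i)` of a separated `A`
  and `X = Y' × A → Y'`, or any affine open cover of a separated `X` over a separated `Y`). Then
  `g⁻¹V ∩ U_β` is affine for every affine `V ⊆ Y` (`isAffineOpen_preimage_inf_face`), the basic opens of
  the affine opens `g⁻¹V ∩ U_i` form a basis meeting every face affinely (`isBasis_inf_face_affine_rel`), and
  **`Cech.isPushforwardAcyclic_obj`**: `Čⁿ(𝓤, M)` is `g_*`-ACYCLIC (`IsPushforwardAcyclic g`, i.e.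
  `Hᵠ⁺¹(g⁻¹V, Čⁿ(𝓤, M)) = 0` for all affine `V`) for every affine-localizing (⊇ quasi-coherent) `M` — the
  relative form of Hartshorne III Thm. 4.5's acyclicity input, feeding "`Rg_*` is computed by the Čech
  complex" (`Modules/DerivedPushforwardAcyclicResolution`, Hartshorne III Prop. 8.1 ∕ 8.7 proof pattern).

Everything PROVED; 0 named facts; no instances. Typed for the cell `pub-hodge-ring2` (brick (K4) «derived flat
base change»); a research route conditional on HC_CM, not a corollary — nothing in this file refers to it.

## References

* R. Hartshorne, *Algebraic Geometry*, GTM 52 (1977), III Lemma 4.2, Prop. 4.3, Thm. 4.5, Prop. 8.1,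
  Prop. 8.7 (proof: Čech computation of higher direct images). [Hartshorne1977]
* The Stacks Project, Tags 01XD (Čech cohomology of affine-faced covers), 01XC, 01XB, 02KE (higher direct
  images via Čech complexes). [StacksProject]
-/

noncomputable section

-- `TopCat.Presheaf`/`Scheme.Modules` are not reducible (as in Mathlib's `AlgebraicGeometry/Modules/Sheaf.lean`).
set_option backward.isDefEq.respectTransparency false

universe u

open CategoryTheory CategoryTheory.Abelian CategoryTheory.Limits Opposite TopologicalSpace AlgebraicGeometry
open Literature.AlgebraicGeometry.HodgeTheory Literature.Algebra.Homology

namespace Literature.AlgebraicGeometry.Modules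

variable {X : Scheme.{u}} {ι : Type u} (U : ι → X.Opens)

namespace Cech

/-! ### §1 The Čech resolution as a quasi-isomorphism `M[0] ⟶ Č•(𝓤, M)` -/

section Augment

variable (M : X.Modules)

/-- **The augmentation `M[0] ⟶ Č•(𝓤, M)`** as a morphism of `ℕ`-indexed cochain complexes out of the
single complex (`ε : M → Č⁰(𝓤, M)`, `x ↦ (x|_{U_i})_i`, with `ε ≫ d = 0`).
[cite: Hartshorne1977, III Lemma 4.2] -/
def augmentι : (CochainComplex.single₀ X.Modules).obj M ⟶ complex U M :=
  (CochainComplex.fromSingle₀Equiv (complex U M) M).symm ⟨augment U M, augment_complex_d U M⟩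

/-- The degree-`0` component of `augmentι` is the augmentation `ε`. [cite: Hartshorne1977, III Lemma 4.2] -/
@[simp] theorem augmentι_f_zero : (augmentι U M).f 0 = augment U M := by
  simp [augmentι]

/-- **The Čech resolution is a quasi-isomorphism**: for a family `𝓤` COVERING `X`, `M[0] ⟶ Č•(𝓤, M)` is a
quasi-isomorphism (exactness of `0 → M → Č⁰ → Č¹ → ⋯`, Hartshorne III Lemma 4.2, in the form used by
derived functors). [cite: Hartshorne1977, III Lemma 4.2] [cite: StacksProject, Tag 01XD] -/
theorem quasiIso_augmentι (hcov : ⨆ i, U i = ⊤) : QuasiIso (augmentι U M) :=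
  ⟨fun n => by
    cases n with
    | zero =>
      rw [CochainComplex.quasiIsoAt₀_iff, ShortComplex.quasiIso_iff_of_zeros]
      · refine (ShortComplex.exact_and_mono_f_iff_of_iso ?_).2 ⟨exact_augment U M hcov, mono_augment U M hcov⟩
        exact ShortComplex.isoMk (Iso.refl _) (Iso.refl _) (Iso.refl _) (by simp) (by simp)
      all_goals rfl
    | succ n =>
      rw [quasiIsoAt_iff_exactAt]
      · exact exactAt_succ U M hcov n
      · exact CochainComplex.exactAt_succ_single_obj M n⟩

end Augment

/-! ### §2 `Čⁿ(𝓤, N)` is acyclic on every open meeting the faces of `𝓤` affinely -/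

section AcyclicOn

variable (n : ℕ)

/-- **Sections of `Čⁿ(𝓤, X₂) → Čⁿ(𝓤, X₃)` over `O` are onto** for a short exact `0 → X₁ → X₂ → X₃ → 0` with
`X₁` acyclic on the opens `O ∩ U_α` (`Γ(O, Čⁿ(𝓤, G)) = Π_α Γ(O ∩ U_α, G)` and `H¹(O ∩ U_α, X₁) = 0`).
[cite: Hartshorne1977, III Thm. 4.5 (proof)] -/
theorem map_app_surjective_of_isAcyclicOn {S : ShortComplex X.Modules} (hS : S.ShortExact) (O : X.Opens)
    (h₁ : ∀ α : Fin (n + 1) → ι, IsAcyclicOn S.X₁ (O ⊓ face U α)) :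
    Function.Surjective ((map U n _ S.g).app O) := fun s => by
  have hsurj : ∀ α : Fin (n + 1) → ι, Function.Surjective (S.g.app (O ⊓ face U α)) := fun α =>
    IsAcyclicOn.surjective_app_of_shortExact hS (O ⊓ face U α) (h₁ α)
  choose t ht using fun α => hsurj α ((s : Sections U n S.X₃ O) α)
  exact ⟨(t : Sections U n S.X₂ O), funext fun α => by rw [map_app_apply]; exact ht α⟩

/-- `Čⁿ(𝓤, I)` is acyclic on every open for `I` injective (it is flasque). [cite: Hartshorne1977, III Prop. 4.3 (proof) and Prop. 2.5] -/
theorem isAcyclicOn_obj_of_injective (I : X.Modules) [Injective I] (O : X.Opens) : IsAcyclicOn (obj U n I) O := by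
  haveI : TopCat.Sheaf.IsFlasque ((modulesToSheaf X).obj I) := isFlasque_of_injective_modules I
  haveI := isFlasque_toSheaf_obj U n I
  exact fun q => IsAcyclicOn.subsingleton_ext_freeSheaf_of_isFlasque (T := X.carrier)
    ((modulesToSheaf X).obj (obj U n I)) O q

/-- **`Hᵠ⁺¹(O, Čⁿ(𝓤, N)) = 0`** for an open `O` meeting every face of `𝓤` in an AFFINE open, `N` acyclic on all
affine opens, given a basis of opens meeting every face of `𝓤` affinely — dimension shifting along
`0 → N → I → Z → 0` with `I` injective: `Čⁿ` of it is short exact, `Čⁿ(𝓤, I)` is flasque, `Γ(O, Čⁿ(I)) → Γ(O, Čⁿ(Z))`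
is onto, and `Z` is again acyclic on affine opens. [cite: Hartshorne1977, III Thm. 4.5 (proof)]
[cite: StacksProject, Tag 01XD] -/
theorem isAcyclicOn_obj
    (hB : Opens.IsBasis {W : X.Opens | ∀ (n : ℕ) (α : Fin (n + 1) → ι), IsAffineOpen (W ⊓ face U α)})
    {O : X.Opens} (hO : ∀ (m : ℕ) (β : Fin (m + 1) → ι), IsAffineOpen (O ⊓ face U β))
    {N : X.Modules} (hN : ∀ W : X.Opens, IsAffineOpen W → IsAcyclicOn N W) :
    IsAcyclicOn (obj U n N) O := by
  intro q
  induction q generalizing N with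
  | zero =>
    let S : ShortComplex X.Modules :=
      ShortComplex.mk (Injective.ι N) (cokernel.π (Injective.ι N)) (cokernel.condition _)
    have hS : S.ShortExact := { exact := ShortComplex.exact_cokernel _ }
    have hT := map_shortExact_of_isBasis U (n := n) hS hB hN
    let T' := (ShortComplex.mk (map U n _ S.f) (map U n _ S.g) (map_comp_eq_zero U n S)).map (modulesToSheaf X)
    have hT' : T'.ShortExact := hT.map_of_exact (modulesToSheaf X)
    haveI : Subsingleton (Ext.{u} (freeSheaf.{u} (Opens.grothendieckTopology X) O) T'.X₂ 1) :=
      isAcyclicOn_obj_of_injective U n (Injective.under N) O 0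
    refine subsingleton_of_forall_eq 0 fun y => ?_
    obtain ⟨x, rfl⟩ := Ext.covariant_sequence_exact₁ (X := freeSheaf.{u} (Opens.grothendieckTopology X) O)
      (hS := hT') y (Subsingleton.elim _ _) (zero_add 1)
    -- lift the section of `Čⁿ(Z)` over `O` defined by `x` to a section of `Čⁿ(I)`
    obtain ⟨s, hs⟩ := map_app_surjective_of_isAcyclicOn U n hS O (fun α => hN _ (hO n α))
      (freeSheafHomEquiv O T'.X₃ (Ext.homEquiv₀ x))
    let ψ : freeSheaf.{u} (Opens.grothendieckTopology X) O ⟶ T'.X₂ := (freeSheafHomEquiv O T'.X₂).symm s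
    have hψ : ψ ≫ T'.g = Ext.homEquiv₀ x := by
      apply (freeSheafHomEquiv O T'.X₃).injective
      rw [freeSheafHomEquiv_comp, Equiv.apply_symm_apply]
      exact hs
    have hx : x = (Ext.mk₀ ψ).comp (Ext.mk₀ T'.g) (add_zero 0) := by
      rw [Ext.mk₀_comp_mk₀, hψ, Ext.mk₀_homEquiv₀_apply]
    rw [hx, Ext.comp_assoc_of_second_deg_zero, hT'.comp_extClass, Ext.comp_zero]
  | succ q ih =>
    let S : ShortComplex X.Modules :=
      ShortComplex.mk (Injective.ι N) (cokernel.π (Injective.ι N)) (cokernel.condition _)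
    have hS : S.ShortExact := { exact := ShortComplex.exact_cokernel _ }
    have hT := map_shortExact_of_isBasis U (n := n) hS hB hN
    let T' := (ShortComplex.mk (map U n _ S.f) (map U n _ S.g) (map_comp_eq_zero U n S)).map (modulesToSheaf X)
    have hT' : T'.ShortExact := hT.map_of_exact (modulesToSheaf X)
    have hZ : ∀ W : X.Opens, IsAffineOpen W → IsAcyclicOn S.X₃ W := fun W hW =>
      IsAcyclicOn.of_shortExact₃ hS W (hN W hW) (IsAcyclicOn.of_injective _ W)
    haveI : Subsingleton (Ext.{u} (freeSheaf.{u} (Opens.grothendieckTopology X) O) T'.X₃ (q + 1)) := ih hZ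
    haveI : Subsingleton (Ext.{u} (freeSheaf.{u} (Opens.grothendieckTopology X) O) T'.X₂ (q + 1 + 1)) :=
      isAcyclicOn_obj_of_injective U n (Injective.under N) O (q + 1)
    exact Literature.AlgebraicGeometry.Motives.Ext.subsingleton_X₁ _ hT' (q + 1)

/-- `Hᵠ⁺¹(O, Čⁿ(𝓤, M)) = 0` for `M` affine-localizing (e.g. quasi-coherent), `O` meeting every face of `𝓤`
affinely, given a basis of opens meeting every face affinely (Serre: `M` is acyclic on affine opens).
[cite: Hartshorne1977, III Thm. 4.5 (proof)] [cite: StacksProject, Tags 01XD and 01XB] -/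
theorem isAcyclicOn_obj_of_isAffineLocalizing
    (hB : Opens.IsBasis {W : X.Opens | ∀ (n : ℕ) (α : Fin (n + 1) → ι), IsAffineOpen (W ⊓ face U α)})
    {O : X.Opens} (hO : ∀ (m : ℕ) (β : Fin (m + 1) → ι), IsAffineOpen (O ⊓ face U β))
    {M : X.Modules} (hM : IsAffineLocalizing M) : IsAcyclicOn (obj U n M) O :=
  isAcyclicOn_obj U n hB hO fun _ hW => IsAcyclicOn.of_isAffineLocalizing hM hW

end AcyclicOn

end Cech

/-! ### §3 Covers with faces affine over a base: `Čⁿ(𝓤, M)` is `g_*`-acyclic -/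

section Relative

variable {Y : Scheme.{u}} (g : X ⟶ Y)

/-- The open `U.ι(U.ι⁻¹ W) = U ⊓ W` of `X` (image of a preimage under the inclusion of an open).
[cite: StacksProject, Tag 01XD (proof)] -/
theorem ι_image_preimage_eq (U W : X.Opens) : U.ι ''ᵁ (U.ι ⁻¹ᵁ W) = U ⊓ W := by
  rw [Scheme.Hom.image_preimage_eq_opensRange_inf, Scheme.Opens.opensRange_ι]

/-- **`g⁻¹V ∩ U_β` is affine for `V ⊆ Y` affine when `U_β → Y` is an affine morphism.**
[cite: StacksProject, Tag 01XD (hypothesis)] [cite: Hartshorne1977, III Prop. 8.7 (proof)] -/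
theorem isAffineOpen_preimage_inf_of_isAffineHom (W : X.Opens) [IsAffineHom (W.ι ≫ g)] {V : Y.Opens}
    (hV : IsAffineOpen V) : IsAffineOpen (g ⁻¹ᵁ V ⊓ W) := by
  have h : IsAffineOpen ((W.ι ≫ g) ⁻¹ᵁ V) := hV.preimage (W.ι ≫ g)
  have h' := h.image_of_isOpenImmersion W.ι
  rw [Scheme.Hom.comp_preimage, ι_image_preimage_eq] at h'
  rwa [inf_comm]

variable (hUaff : ∀ {m : ℕ} (β : Fin (m + 1) → ι), IsAffineHom ((face U β).ι ≫ g))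
include hUaff

/-- The faces of `𝓤` meet `g⁻¹V` in affine opens, `V` affine. [cite: Hartshorne1977, III Prop. 8.7 (proof)] -/
theorem isAffineOpen_preimage_inf_face {V : Y.Opens} (hV : IsAffineOpen V) {m : ℕ} (β : Fin (m + 1) → ι) :
    IsAffineOpen (g ⁻¹ᵁ V ⊓ face U β) :=
  haveI := hUaff β
  isAffineOpen_preimage_inf_of_isAffineHom g (face U β) hV

/-- In particular `g⁻¹V ∩ U_i` is affine. [cite: Hartshorne1977, III Prop. 8.7 (proof)] -/
theorem isAffineOpen_preimage_inf {V : Y.Opens} (hV : IsAffineOpen V) (i : ι) : IsAffineOpen (g ⁻¹ᵁ V ⊓ U i) := by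
  rw [← face_const_zero U i]
  exact isAffineOpen_preimage_inf_face U g hUaff hV _

/-- **The basic opens of the affine opens `g⁻¹V ∩ U_i` meet every face of `𝓤` in an affine open, and form a
basis of `X`** (when `𝓤` covers `X`): `D(f) ∩ U_α = D(f|_{g⁻¹V ∩ U_i ∩ U_α})` is a basic open of the affine
`g⁻¹V ∩ U_{(i,α)}`. [cite: StacksProject, Tag 01XD (proof)] -/
theorem isBasis_inf_face_affine_rel (hcov : ⨆ i, U i = ⊤) :
    Opens.IsBasis {W : X.Opens | ∀ (n : ℕ) (α : Fin (n + 1) → ι), IsAffineOpen (W ⊓ face U α)} := by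
  rw [Opens.isBasis_iff_nbhd]
  intro O x hx
  have hxU : x ∈ (⨆ i, U i : X.Opens) := by rw [hcov]; trivial
  obtain ⟨i, hi⟩ := Opens.mem_iSup.mp hxU
  -- an affine open `V ⊆ Y` containing `g x`
  obtain ⟨V, hV, hxV, -⟩ := Opens.isBasis_iff_nbhd.mp Y.isBasis_affineOpens (Opens.mem_top (g.base x))
  have hA : IsAffineOpen (g ⁻¹ᵁ V ⊓ U i) := isAffineOpen_preimage_inf U g hUaff hV i
  have hxA : x ∈ g ⁻¹ᵁ V ⊓ U i ⊓ O := ⟨⟨hxV, hi⟩, hx⟩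
  obtain ⟨f, hfO, hxf⟩ := hA.exists_basicOpen_le ⟨x, hxA⟩ (show x ∈ g ⁻¹ᵁ V ⊓ U i from ⟨hxV, hi⟩)
  refine ⟨X.basicOpen f, fun n α => ?_, hxf, hfO.trans inf_le_right⟩
  have hle : g ⁻¹ᵁ V ⊓ U i ⊓ face U α ≤ g ⁻¹ᵁ V ⊓ U i := inf_le_left
  have e : X.basicOpen f ⊓ face U α = X.basicOpen (X.presheaf.map (homOfLE hle).op f) := by
    rw [Scheme.basicOpen_res, inf_assoc, inf_comm (face U α) (X.basicOpen f), ← inf_assoc,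
      inf_eq_right.mpr (X.basicOpen_le f)]
  rw [e]
  have hA' : IsAffineOpen (g ⁻¹ᵁ V ⊓ U i ⊓ face U α) := by
    rw [inf_assoc, ← face_cons]
    exact isAffineOpen_preimage_inf_face U g hUaff hV _
  exact hA'.basicOpen _

/-- **`Čⁿ(𝓤, M)` is `g_*`-acyclic** (`Hᵠ⁺¹(g⁻¹V, Čⁿ(𝓤, M)) = 0` for every affine `V ⊆ Y` and every `q`) for `M`
affine-localizing (⊇ quasi-coherent) and a cover `𝓤` of `X` whose faces are affine over `Y` — the relative
form of the acyclicity of Čech sheaves (Hartshorne III 4.5 ∕ 8.7: on `g⁻¹V` the family `𝓤 ∩ g⁻¹V` has affine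
faces). [cite: Hartshorne1977, III Prop. 8.7 (proof) and Thm. 4.5] [cite: StacksProject, Tags 02KE and 01XD] -/
theorem Cech.isPushforwardAcyclic_obj (hcov : ⨆ i, U i = ⊤) {M : X.Modules} (hM : IsAffineLocalizing M)
    (n : ℕ) : IsPushforwardAcyclic g (Cech.obj U n M) := fun _ hV =>
  Cech.isAcyclicOn_obj_of_isAffineLocalizing U n (isBasis_inf_face_affine_rel U g hUaff hcov)
    (fun _ β => isAffineOpen_preimage_inf_face U g hUaff hV β) hM

end Relative

end Literature.AlgebraicGeometry.Modules

end
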